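import Mathlib

/-!
# Stub ideation k = 2 (FAMILY 2 — RESHAPE) for `stub_poorRigidCore` — typed companion
(crux `HyperoctahedralThreshold`, stmt-MatrixMultiplication-10883, live line `Lines/refutation_local_symmetry.lean`;
plan `STUB-IDEAS-stub_poorRigidCore-2.md` in this directory)

Vocabulary = the line's: colours `μ c` (fixed-point-free involutions of `Fin n`), words act on the right by
`z.foldl (fun v c => μ c v)`, "cyclically reduced" = `List.IsChain (· ≠ ·) (z ++ z)`.

CONTENTS.  Plan A (R-elimination by LP duality): helpers A0–A3 and the assembly
`stub_poorRigidCore_of_fracBulkCore : FracBulkCore → <stub_poorRigidCore verbatim>` are PROVED here (sorry-free), so the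
`R`-free residual `FracBulkCore` is a certified sufficient condition for the stub.  Plan C helpers C1–C3 are PROVED.  Plan B: the
residual `CutFreeCore` is stated and the induction wrapper `concl_all_of_cutFreeCore` is the file's only `sorry` (size M–L; it needs the
tree's `…SparseCutOGL.sparseCut_oneGadget` and `stub_patternTwin`, not imported here to keep the file Mathlib-only).
Nothing is registered; a prover copies what it needs into a `--supports stmt-MatrixMultiplication-10883` file.
-/

set_option linter.unusedVariables false
set_option linter.dupNamespace false

namespace Summit.MatrixMultiplication.MatrixMultiplication.Cruxes.HyperoctahedralThreshold.StubIdeas2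

open Finset

/-- **C2** (Markov excision).  The elements of `s` carrying at least `θ` of a mass `f` are at most `(Σ f)/θ` in number.
Use: `f x :=` closed (or twin-pair-weighted) walks of length `j` at `x`, `θ := K · (average)`; put the dense vertices into `F ⊇ R`;
`|F| ≤ n/(8L)` keeps every landed `F`-avoiding supply applicable. [folklore] -/
theorem card_filter_le_mul_le_sum {α : Type*} (s : Finset α) (f : α → ℕ) (θ : ℕ) :
    θ * (s.filter fun x => θ ≤ f x).card ≤ ∑ x ∈ s, f x := by
  calc θ * (s.filter fun x => θ ≤ f x).card = ∑ x ∈ s.filter (fun x => θ ≤ f x), θ := by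
        rw [sum_const, smul_eq_mul, mul_comm]
    _ ≤ ∑ x ∈ s.filter (fun x => θ ≤ f x), f x := sum_le_sum fun x hx => (mem_filter.mp hx).2
    _ ≤ ∑ x ∈ s, f x := sum_le_sum_of_subset_of_nonneg (filter_subset _ _) (fun _ _ _ => Nat.zero_le _)

/-- **C3** (excess is squared in the pair supply; Cauchy–Schwarz).  With `T = Σ_w N_w` based closed walks on `C = #W` words,
`Σ_w N_w (N_w − 1) ≥ T²/C − T`: a closed-walk excess `D = T/2^ℓ > 3` is automatically a twin-pair supply `≳ (D²/3 − D) 2^ℓ`. [folklore] -/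
theorem sq_sum_le_card_mul_pairs {β : Type*} (W : Finset β) (N : β → ℕ) :
    (∑ w ∈ W, N w) ^ 2 ≤ W.card * ∑ w ∈ W, N w * (N w - 1) + W.card * ∑ w ∈ W, N w := by
  have h1 : (∑ w ∈ W, N w) ^ 2 ≤ W.card * ∑ w ∈ W, N w ^ 2 := sq_sum_le_card_mul_sum_sq
  have h2 : ∑ w ∈ W, N w ^ 2 = ∑ w ∈ W, N w * (N w - 1) + ∑ w ∈ W, N w := by
    rw [← sum_add_distrib]
    refine sum_congr rfl fun w _ => ?_
    rcases Nat.eq_zero_or_pos (N w) with h | h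
    · simp [h]
    · have : N w - 1 + 1 = N w := Nat.sub_add_cancel h
      calc N w ^ 2 = N w * (N w - 1 + 1) := by rw [this, sq]
        _ = N w * (N w - 1) + N w := by ring
  rw [h2, mul_add] at h1
  exact h1

/-- **A1** (fractional transversal lemma = weak LP duality).  A non-negative weighting of a family of finite sets, feasible at
every point of `R` (total weight through the point `≤ 1`) and of total weight `> |R|`, has a member disjoint from `R`. [folklore] -/
theorem exists_disjoint_of_card_lt_weight {ι α : Type*} [Fintype ι] [DecidableEq α]
    (S : ι → Finset α) (w : ι → ℝ) (R : Finset α) (hw : ∀ i, 0 ≤ w i)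
    (hfeas : ∀ v ∈ R, (∑ i ∈ univ.filter (fun i => v ∈ S i), w i) ≤ 1)
    (hbig : (R.card : ℝ) < ∑ i, w i) : ∃ i, Disjoint (S i) R := by
  by_contra hcon
  push Not at hcon
  -- every member meets R: pick a point
  have hne : ∀ i, (S i ∩ R).Nonempty := fun i => not_disjoint_iff_nonempty_inter.mp (hcon i)
  choose v hv using hne
  have hvS : ∀ i, v i ∈ S i := fun i => (mem_inter.mp (hv i)).1
  have hvR : ∀ i, v i ∈ R := fun i => (mem_inter.mp (hv i)).2
  have key : ∑ i, w i ≤ ∑ r ∈ R, ∑ i ∈ univ.filter (fun i => r ∈ S i), w i := by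
    calc ∑ i, w i = ∑ i, ∑ r ∈ R, (if v i = r then w i else 0) := by
          refine sum_congr rfl fun i _ => ?_
          rw [Finset.sum_ite_eq R (v i) (fun _ => w i)]
          simp [hvR i]
      _ = ∑ r ∈ R, ∑ i, (if v i = r then w i else 0) := sum_comm
      _ ≤ ∑ r ∈ R, ∑ i ∈ univ.filter (fun i => r ∈ S i), w i := by
          refine sum_le_sum fun r hr => ?_
          rw [sum_filter]
          refine sum_le_sum fun i _ => ?_
          by_cases h : v i = r
          · subst h; simp [hvS i]
          · simp [h]; split_ifs <;> simp [hw i]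
  have : ∑ r ∈ R, ∑ i ∈ univ.filter (fun i => r ∈ S i), w i ≤ R.card := by
    calc ∑ r ∈ R, ∑ i ∈ univ.filter (fun i => r ∈ S i), w i ≤ ∑ r ∈ R, (1 : ℝ) := sum_le_sum hfeas
      _ = R.card := by simp
  linarith

/-- **A2** (canonical weights are feasible).  With `deg u := #{j : u ∈ S j}` and `w i := 1 / max_{u ∈ S i} deg u`, the total weight
through any point is `≤ 1`.  Hot vertices discount only their own members. [folklore] -/
theorem canonicalWeights_feasible {ι α : Type*} [Fintype ι] [DecidableEq α] (S : ι → Finset α) (v : α) :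
    (∑ i ∈ univ.filter (fun i => v ∈ S i),
      (1 : ℝ) / (((S i).sup fun u => (univ.filter fun j => u ∈ S j).card : ℕ) : ℝ)) ≤ 1 := by
  set d : ℕ := (univ.filter fun j => v ∈ S j).card with hd
  have hle : ∀ i ∈ univ.filter (fun i => v ∈ S i),
      (1 : ℝ) / (((S i).sup fun u => (univ.filter fun j => u ∈ S j).card : ℕ) : ℝ) ≤ 1 / (d : ℝ) := by
    intro i hi
    have hv : v ∈ S i := (mem_filter.mp hi).2
    have h1 : d ≤ (S i).sup fun u => (univ.filter fun j => u ∈ S j).card :=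
      Finset.le_sup (f := fun u => (univ.filter fun j => u ∈ S j).card) hv
    have hdpos : 0 < d := by
      rw [hd]; exact Finset.card_pos.mpr ⟨i, mem_filter.mpr ⟨mem_univ _, hv⟩⟩
    exact one_div_le_one_div_of_le (by exact_mod_cast hdpos) (by exact_mod_cast h1)
  calc (∑ i ∈ univ.filter (fun i => v ∈ S i),
        (1 : ℝ) / (((S i).sup fun u => (univ.filter fun j => u ∈ S j).card : ℕ) : ℝ))
        ≤ ∑ i ∈ univ.filter (fun i => v ∈ S i), 1 / (d : ℝ) := sum_le_sum hle
    _ = d * (1 / (d : ℝ)) := by rw [sum_const, nsmul_eq_mul]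
    _ ≤ 1 := by
        rcases Nat.eq_zero_or_pos d with h | h
        · simp [h]
        · rw [mul_one_div_cancel (by exact_mod_cast h.ne')]

/-- The conclusion of the core: one clean closed rung walk of `k + 1 ≤ n^{1/4}` rungs avoiding `R` (verbatim the `∃ (k : ℕ) (p q …)`
block of `stub_poorRigidCore` / `stub_cleanWalk`). -/
def Concl (n : ℕ) (μ : Fin 3 → Equiv.Perm (Fin n)) (R : Finset (Fin n)) : Prop :=
  ∃ (k : ℕ) (p q : Fin (k + 1) → Fin n) (col : Fin (k + 1) → Fin 3), (∀ i, p i ≠ q i) ∧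
    (∀ i, (μ (col i) (p i) = p (i + 1) ∧ μ (col i) (q i) = q (i + 1)) ∨
      (μ (col i) (p i) = q (i + 1) ∧ μ (col i) (q i) = p (i + 1))) ∧
    (∀ i, col i ≠ col (i + 1)) ∧
    (∀ i j, (p i = p j ∧ q i = q j) ∨ (p i = q j ∧ q i = p j) ∨
      (p i ≠ p j ∧ p i ≠ q j ∧ q i ≠ p j ∧ q i ≠ q j)) ∧
    (∀ i, p i ∉ R ∧ q i ∉ R) ∧ ((k : ℝ) + 1) ≤ (n : ℝ) ^ ((1 : ℝ) / 4)

/-- **C1**: the conclusion is antitone in the forbidden set. -/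
theorem concl_mono {n : ℕ} (μ : Fin 3 → Equiv.Perm (Fin n)) {R F : Finset (Fin n)} (hRF : R ⊆ F)
    (h : Concl n μ F) : Concl n μ R := by
  obtain ⟨k, p, q, col, h1, h2, h3, h4, h5, h6⟩ := h
  exact ⟨k, p, q, col, h1, h2, h3, h4, fun i => ⟨fun hp => (h5 i).1 (hRF hp), fun hq => (h5 i).2 (hRF hq)⟩, h6⟩

/-- RIGID at an abstract budget `r` (the core's rigidity hypothesis with `R.card` replaced by `r`; at `r = R.card` it is that
hypothesis verbatim). -/
def RigidAt (n : ℕ) (μ : Fin 3 → Equiv.Perm (Fin n)) (r : ℕ) : Prop :=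
  ∀ z : List (Fin 3), z ≠ [] → List.IsChain (· ≠ ·) (z ++ z) → (z.length : ℝ) ≤ (n : ℝ) ^ ((1 : ℝ) / 4) →
    ∀ (m : ℕ) (x : Fin m → Fin n), Function.Injective x → (∀ i, z.foldl (fun v c => μ c v) (x i) = x i) →
      (∀ i j, ∀ s t : Fin z.length,
        ((z.take (s : ℕ)).foldl (fun v c => μ c v) (x i) = (z.take (t : ℕ)).foldl (fun v c => μ c v) (x i) ↔
          (z.take (s : ℕ)).foldl (fun v c => μ c v) (x j) = (z.take (t : ℕ)).foldl (fun v c => μ c v) (x j))) →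
      m ≤ 2 * (z.length * r) + z.length ^ 2 + 1

/-- RIGID is antitone in the budget. -/
theorem rigidAt_mono {n : ℕ} (μ : Fin 3 → Equiv.Perm (Fin n)) {r r' : ℕ} (hrr : r ≤ r') (h : RigidAt n μ r) :
    RigidAt n μ r' := by
  intro z hz hc hl m x hx hfix hpat
  have := h z hz hc hl m x hx hfix hpat
  calc m ≤ 2 * (z.length * r) + z.length ^ 2 + 1 := this
    _ ≤ 2 * (z.length * r') + z.length ^ 2 + 1 := by gcongr

/-- **A0**: the core's hypothesis implies the `R`-FREE hypothesis `RigidAt n μ ⌊n^{3/4}⌋₊`. -/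
theorem rigidAt_floor_of_rigid (n : ℕ) (μ : Fin 3 → Equiv.Perm (Fin n)) (R : Finset (Fin n))
    (hR : (R.card : ℝ) ≤ (n : ℝ) ^ ((3 : ℝ) / 4)) (h : RigidAt n μ R.card) :
    RigidAt n μ ⌊(n : ℝ) ^ ((3 : ℝ) / 4)⌋₊ :=
  rigidAt_mono μ (Nat.le_floor hR) h

/-- Cleanness of ONE walk in the core's format (the `R`-clause and the length clause removed). -/
def IsCleanWalk (n k : ℕ) (μ : Fin 3 → Equiv.Perm (Fin n)) (p q : Fin (k + 1) → Fin n)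
    (col : Fin (k + 1) → Fin 3) : Prop :=
  (∀ i, p i ≠ q i) ∧
    (∀ i, (μ (col i) (p i) = p (i + 1) ∧ μ (col i) (q i) = q (i + 1)) ∨
      (μ (col i) (p i) = q (i + 1) ∧ μ (col i) (q i) = p (i + 1))) ∧
    (∀ i, col i ≠ col (i + 1)) ∧
    (∀ i j, (p i = p j ∧ q i = q j) ∨ (p i = q j ∧ q i = p j) ∨
      (p i ≠ p j ∧ p i ≠ q j ∧ q i ≠ p j ∧ q i ≠ q j))

/-- **A3** (packaging).  A weighted family of clean walks of `k + 1 ≤ n^{1/4}` rungs, feasible at every vertex and of total weight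
`> |R|`, yields the core's conclusion for `R`. -/
theorem concl_of_fracPacking (n k N : ℕ) (μ : Fin 3 → Equiv.Perm (Fin n)) (R : Finset (Fin n))
    (col : Fin N → Fin (k + 1) → Fin 3) (p q : Fin N → Fin (k + 1) → Fin n) (w : Fin N → ℝ)
    (hclean : ∀ a, IsCleanWalk n k μ (p a) (q a) (col a)) (hw : ∀ a, 0 ≤ w a)
    (hfeas : ∀ v : Fin n, (∑ a ∈ univ.filter (fun a => ∃ i, p a i = v ∨ q a i = v), w a) ≤ 1)
    (hbig : (R.card : ℝ) < ∑ a, w a) (hk : ((k : ℝ) + 1) ≤ (n : ℝ) ^ ((1 : ℝ) / 4)) :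
    Concl n μ R := by
  classical
  let S : Fin N → Finset (Fin n) := fun a => univ.image (p a) ∪ univ.image (q a)
  have hmem : ∀ a v, v ∈ S a ↔ ∃ i, p a i = v ∨ q a i = v := by
    intro a v
    simp only [S, mem_union, mem_image, mem_univ, true_and]
    constructor
    · rintro (⟨i, hi⟩ | ⟨i, hi⟩)
      · exact ⟨i, Or.inl hi⟩
      · exact ⟨i, Or.inr hi⟩
    · rintro ⟨i, hi | hi⟩
      · exact Or.inl ⟨i, hi⟩
      · exact Or.inr ⟨i, hi⟩
  have hfeas' : ∀ v ∈ R, (∑ a ∈ univ.filter (fun a => v ∈ S a), w a) ≤ 1 := by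
    intro v _
    have : univ.filter (fun a => v ∈ S a) = univ.filter (fun a => ∃ i, p a i = v ∨ q a i = v) :=
      filter_congr fun a _ => hmem a v
    rw [this]; exact hfeas v
  obtain ⟨a, ha⟩ := exists_disjoint_of_card_lt_weight S w R hw hfeas' hbig
  obtain ⟨h1, h2, h3, h4⟩ := hclean a
  refine ⟨k, p a, q a, col a, h1, h2, h3, h4, fun i => ⟨fun hp => ?_, fun hq => ?_⟩, hk⟩
  · exact disjoint_left.mp ha ((hmem a _).mpr ⟨i, Or.inl rfl⟩) hp
  · exact disjoint_left.mp ha ((hmem a _).mpr ⟨i, Or.inr rfl⟩) hq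

/-- **Residual X_A** (`R`-free "fractional bulk core"): for large `n`, RIGID at budget `⌊n^{3/4}⌋₊` (POOR is implied, tree
`stub_poorOfRigid`) forces a vertex-feasibly weighted family of clean walks at ONE scale `k + 1 ≤ n^{1/4}` of total weight `> n^{3/4}`. -/
def FracBulkCore : Prop :=
  ∃ n₀ : ℕ, ∀ n ≥ n₀, ∀ μ : Fin 3 → Equiv.Perm (Fin n), (∀ i, μ i * μ i = 1 ∧ ∀ v, μ i v ≠ v) →
    RigidAt n μ ⌊(n : ℝ) ^ ((3 : ℝ) / 4)⌋₊ →
    ∃ (k N : ℕ) (col : Fin N → Fin (k + 1) → Fin 3) (p q : Fin N → Fin (k + 1) → Fin n) (w : Fin N → ℝ),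
      (∀ a, IsCleanWalk n k μ (p a) (q a) (col a)) ∧ (∀ a, 0 ≤ w a) ∧
      (∀ v : Fin n, (∑ a ∈ univ.filter (fun a => ∃ i, p a i = v ∨ q a i = v), w a) ≤ 1) ∧
      (n : ℝ) ^ ((3 : ℝ) / 4) < ∑ a, w a ∧ ((k : ℝ) + 1) ≤ (n : ℝ) ^ ((1 : ℝ) / 4)

/-- **Assembly A** (kernel-checked): `FracBulkCore → stub_poorRigidCore` (statement of the stub verbatim,
`Lines/refutation_local_symmetry.lean:271`).  POOR is not used. -/
theorem stub_poorRigidCore_of_fracBulkCore (hX : FracBulkCore) :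
    ∃ n₀ : ℕ, ∀ n ≥ n₀, ∀ μ : Fin 3 → Equiv.Perm (Fin n), (∀ i, μ i * μ i = 1 ∧ ∀ v, μ i v ≠ v) → ∀ R : Finset (Fin n), (R.card : ℝ) ≤ (n : ℝ) ^ ((3 : ℝ) / 4) → (∀ z : List (Fin 3), z ≠ [] → List.IsChain (· ≠ ·) (z ++ z) → (z.length : ℝ) ≤ (n : ℝ) ^ ((1 : ℝ) / 4) → ∀ (m : ℕ) (x : Fin m → Fin n), Function.Injective x → (∀ i, z.foldl (fun v c => μ c v) (x i) = x i) → m ≤ (4 * z.length ^ 2) ^ (Nat.log 2 z.length + 1) * (R.card + 1)) → (∀ z : List (Fin 3), z ≠ [] → List.IsChain (· ≠ ·) (z ++ z) → (z.length : ℝ) ≤ (n : ℝ) ^ ((1 : ℝ) / 4) → ∀ (m : ℕ) (x : Fin m → Fin n), Function.Injective x → (∀ i, z.foldl (fun v c => μ c v) (x i) = x i) → (∀ i j, ∀ s t : Fin z.length, ((z.take (s : ℕ)).foldl (fun v c => μ c v) (x i) = (z.take (t : ℕ)).foldl (fun v c => μ c v) (x i) ↔ (z.take (s : ℕ)).foldl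 (fun v c => μ c v) (x j) = (z.take (t : ℕ)).foldl (fun v c => μ c v) (x j))) → m ≤ 2 * (z.length * R.card) + z.length ^ 2 + 1) → ∃ (k : ℕ) (p q : Fin (k + 1) → Fin n) (col : Fin (k + 1) → Fin 3), (∀ i, p i ≠ q i) ∧ (∀ i, (μ (col i) (p i) = p (i + 1) ∧ μ (col i) (q i) = q (i + 1)) ∨ (μ (col i) (p i) = q (i + 1) ∧ μ (col i) (q i) = p (i + 1))) ∧ (∀ i, col i ≠ col (i + 1)) ∧ (∀ i j, (p i = p j ∧ q i = q j) ∨ (p i = q j ∧ q i = p j) ∨ (p i ≠ p j ∧ p i ≠ q j ∧ q i ≠ p j ∧ q i ≠ q j)) ∧ (∀ i, p i ∉ R ∧ q i ∉ R) ∧ ((k : ℝ) + 1) ≤ (n : ℝ) ^ ((1 : ℝ) / 4) := by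
  obtain ⟨n₀, hn₀⟩ := hX
  refine ⟨n₀, fun n hn μ hμ R hR _hpoor hrigid => ?_⟩
  have hrig : RigidAt n μ R.card := hrigid
  obtain ⟨k, N, col, p, q, w, hclean, hw, hfeas, hbig, hk⟩ :=
    hn₀ n hn μ hμ (rigidAt_floor_of_rigid n μ R hR hrig)
  exact concl_of_fracPacking n k N μ R col p q w hclean hw hfeas (lt_of_le_of_lt hR hbig) hk

/-! ## Plan B — strengthen-to-induct: the wrapper around the landed `…SparseCutOGL` (residual `CutFreeCore`) -/

/-- The boundary layer of `S` (vertices of `S` with a colour-neighbour outside), as in `…SparseCutOGL`. -/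
def bdry {n : ℕ} (μ : Fin 3 → Equiv.Perm (Fin n)) (S : Finset (Fin n)) : Finset (Fin n) :=
  S.filter fun v => ∃ c, μ c v ∉ S

/-- **Residual X_B**: the core under the free normalisation NOCUT(n₀) — no even set `S`, `n₀ ≤ |S| ≤ n/2`, whose two boundary layers
both have `≤ |S|^{3/4}/16` vertices.  The tolerance threshold is the SAME `n₀` as the existential (this is what closes the induction in
`concl_all_of_cutFreeCore`); sparse pieces smaller than `n₀` are tolerated, not excluded. -/
def CutFreeCore : Prop :=
  ∃ n₀ : ℕ, ∀ n ≥ n₀, ∀ μ : Fin 3 → Equiv.Perm (Fin n), (∀ i, μ i * μ i = 1 ∧ ∀ v, μ i v ≠ v) →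
    (∀ S : Finset (Fin n), Even S.card → n₀ ≤ S.card → 2 * S.card ≤ n →
      (S.card : ℝ) ^ ((3 : ℝ) / 4) / 16 < (bdry μ S).card ∨ (S.card : ℝ) ^ ((3 : ℝ) / 4) / 16 < (bdry μ Sᶜ).card) →
    ∀ R : Finset (Fin n), (R.card : ℝ) ≤ (n : ℝ) ^ ((3 : ℝ) / 4) → RigidAt n μ R.card → Concl n μ R

/-- **B1** (induction wrapper; size M–L; the file's only `sorry`): strong induction on `n` over the FULL one-gadget statement
`∀ μ fpf, ∀ R, |R| ≤ n^{3/4} → Concl n μ R`: a sparse cut with both sides `≥ n₀` recurses by `sparseCut_oneGadget` (tree `…SparseCutOGL`),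
a non-rigid host is discharged outright by `stub_patternTwin` (p107640; rich hosts are non-rigid by `stub_poorOfRigid`), and the rest is
`CutFreeCore`.  The stub follows by dropping its two hypotheses. -/
theorem concl_all_of_cutFreeCore (hX : CutFreeCore) :
    ∃ n₀ : ℕ, ∀ n ≥ n₀, ∀ μ : Fin 3 → Equiv.Perm (Fin n), (∀ i, μ i * μ i = 1 ∧ ∀ v, μ i v ≠ v) →
      ∀ R : Finset (Fin n), (R.card : ℝ) ≤ (n : ℝ) ^ ((3 : ℝ) / 4) → Concl n μ R := by
  sorry

end Summit.MatrixMultiplication.MatrixMultiplication.Cruxes.HyperoctahedralThreshold.StubIdeas2
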